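import Literature.ModelTheory.ExponentialFields.ModelTheoryPreds

/-!
# Model-theoretic predicates: discharges of `HasQE.isModelComplete` and two companions

Proof file for named facts of `Literature/ModelTheory/ExponentialFields/ModelTheoryPreds.lean`
(all statements are used verbatim; nothing is restated or weakened):

* `FirstOrder.Language.Theory.HasQE.isModelComplete_holds` — quantifier elimination implies model
  completeness (Marker, *Model Theory: An Introduction*, GTM 217 (2002), Prop. 3.1.14).
* `FirstOrder.Language.Theory.IsModelComplete.exists_elementaryEmbedding_holds` — in a model
  complete theory every embedding between models underlies an elementary embedding (Marker 2002,
  Def. 3.1.13 and the remark following it: "stated in terms of embeddings: `T` is model-complete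
  if and only if all embeddings are elementary").
* `FirstOrder.Language.Theory.HasQE.isComplete_of_qf_sentences_decided_holds` — a satisfiable
  theory with quantifier elimination that decides every quantifier-free sentence is complete
  (the argument of Marker 2002, proof of Cor. 3.2.3, where completeness of `ACF_p` is derived from
  quantifier elimination through quantifier-free sentences).

## Proof architecture

* Prop. 3.1.14, following the printed proof: given `φ(x̄)` and `ā ∈ M`, quantifier elimination
  yields a quantifier-free `ψ` with `T ⊨ ∀ x̄, φ ↔ ψ`; as `M, N ⊨ T` we get `M ⊨ φ(ā) ↔ M ⊨ ψ(ā)` and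
  `N ⊨ φ(f ā) ↔ N ⊨ ψ(f ā)` (`Theory.Iff.realize_iff`), and quantifier-free formulas are preserved
  under substructures and extensions, i.e. preserved and reflected by embeddings
  (`BoundedFormula.IsQF.realize_embedding`).
* Def. 3.1.13 (remark): `IsModelComplete T` is literally the field `map_formula'` of
  `FirstOrder.Language.ElementaryEmbedding`, so the elementary embedding is `⟨f, h M N f⟩`.
* Proof of Cor. 3.2.3, abstracted: a sentence `φ` is a formula in the empty variable type; relabel
  it to `Fin 0` variables, apply quantifier elimination to get a quantifier-free `ψ`, relabel `ψ`
  back to a sentence `ψ'` (still quantifier-free, `IsQF.relabel`); in every model `M ⊨ T`,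
  `M ⊨ φ ↔ M ⊨ ψ'`; the hypothesis decides `ψ'`, hence `T` decides `φ`
  (`Theory.models_sentence_iff`).

## References

* D. Marker, *Model Theory: An Introduction*, Graduate Texts in Mathematics 217, Springer (2002),
  §3.1: Def. 3.1.1 (quantifier elimination), Def. 3.1.13 (model completeness) and the remark
  following it, Prop. 3.1.14 (QE ⇒ model complete), Prop. 3.1.15 (completeness test for
  model-complete theories); §3.2: proof of Cor. 3.2.3 (completeness of `ACF_p` via quantifier-free
  sentences).
-/

universe u v

open scoped FirstOrder

namespace FirstOrder

namespace Language

namespace Theory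

variable {L : Language.{u, v}} {T : L.Theory}

/-- Discharge of the named fact `HasQE.isModelComplete` (Marker 2002, Prop. 3.1.14: "If `T` has
quantifier elimination, then `T` is model-complete"), following the printed proof: given `φ(x̄)`,
quantifier elimination yields a quantifier-free `ψ` with `T ⊨ ∀ x̄, φ ↔ ψ`; both `M` and `N` are
models of `T`, so `M ⊨ φ(ā) ↔ M ⊨ ψ(ā)` and `N ⊨ φ(f ā) ↔ N ⊨ ψ(f ā)`; and quantifier-free formulas
are preserved under substructures and extensions, i.e. preserved and reflected by embeddings
(`BoundedFormula.IsQF.realize_embedding`). [cite: Marker2002, Prop. 3.1.14] -/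
theorem HasQE.isModelComplete_holds : HasQE.isModelComplete (T := T) := by
  intro h M N f n φ x
  obtain ⟨ψ, hψ, hiff⟩ := h n φ
  rw [hiff.realize_iff (M := (N : Type _)), hiff.realize_iff (M := (M : Type _))]
  unfold Formula.Realize
  rw [← hψ.realize_embedding f (v := x) (xs := (default : Fin 0 → M))]
  exact iff_of_eq (by congr 1; funext i; exact Fin.elim0 i)

/-- Discharge of the named fact `IsModelComplete.exists_elementaryEmbedding` (Marker 2002,
Def. 3.1.13 and the remark following it: "stated in terms of embeddings: `T` is model-complete if
and only if all embeddings are elementary"): the defining condition of `IsModelComplete` for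
`f : M ↪[L] N` is exactly the elementarity field of `FirstOrder.Language.ElementaryEmbedding`, so
`f` underlies the elementary embedding `⟨f, h M N f⟩`. [cite: Marker2002, Def. 3.1.13] -/
theorem IsModelComplete.exists_elementaryEmbedding_holds :
    IsModelComplete.exists_elementaryEmbedding (T := T) := by
  intro h M N f
  refine ⟨⟨f, fun n φ x => h M N f n φ x⟩, ?_⟩
  ext x
  rfl

/-- Discharge of the named fact `HasQE.isComplete_of_qf_sentences_decided`: if `T` is satisfiable,
has quantifier elimination and decides every quantifier-free sentence, then `T` is complete. This
abstracts the argument of Marker 2002, proof of Cor. 3.2.3 ("By quantifier elimination, there is a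
quantifier-free sentence `ψ` such that `ACF ⊨ φ ↔ ψ` … Thus `K ⊨ φ ⇔ K ⊨ ψ ⇔ L ⊨ ψ ⇔ L ⊨ φ`"): a
sentence `φ` is relabelled to a formula in `Fin 0` variables, quantifier elimination gives a
quantifier-free `ψ`, which relabelled back is a quantifier-free sentence `ψ'` with `M ⊨ φ ↔ M ⊨ ψ'`
in every model `M` of `T`; as `T` decides `ψ'`, it decides `φ`.
[cite: Marker2002, proof of Cor. 3.2.3] -/
theorem HasQE.isComplete_of_qf_sentences_decided_holds :
    HasQE.isComplete_of_qf_sentences_decided (T := T) := by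
  intro h hsat hqf
  refine ⟨hsat, fun φ => ?_⟩
  obtain ⟨ψ, hψ, hiff⟩ := h 0 (φ.relabel (Empty.elim : Empty → Fin 0))
  -- the quantifier-free sentence equivalent to `φ`
  set ψ' : L.Sentence := ψ.relabel (fun i => Fin.elim0 i : Fin 0 → Empty) with hψ'_def
  have hψ' : BoundedFormula.IsQF ψ' := hψ.relabel _
  have key : ∀ M : Theory.ModelType.{u, v, max u v} T, M ⊨ φ ↔ M ⊨ ψ' := fun M => by
    have e₁ : M ⊨ φ ↔ (φ.relabel (Empty.elim : Empty → Fin 0)).Realize (default : Fin 0 → M) := by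
      rw [Formula.realize_relabel,
        Subsingleton.elim ((default : Fin 0 → M) ∘ (Empty.elim : Empty → Fin 0)) default]
      rfl
    have e₂ : M ⊨ ψ' ↔ ψ.Realize (default : Fin 0 → M) := by
      change Formula.Realize ψ' (default : Empty → M) ↔ _
      rw [hψ'_def, Formula.realize_relabel,
        Subsingleton.elim ((default : Empty → M) ∘ (fun i => Fin.elim0 i : Fin 0 → Empty)) default]
    rw [e₁, e₂]
    exact hiff.realize_iff
  rcases hqf ψ' hψ' with h₁ | h₁
  · left
    rw [models_sentence_iff] at h₁ ⊢
    exact fun M => (key M).2 (h₁ M)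
  · right
    rw [models_sentence_iff] at h₁ ⊢
    intro M
    rw [Sentence.realize_not, key M]
    exact (Sentence.realize_not M).1 (h₁ M)

end Theory

end Language

end FirstOrder


/-!
## Robinson's test, easy direction

The named fact `Theory.isModelComplete_iff_forall_exists_isExistential` (Marker 2002,
Prop. 3.1.12: model completeness ⇔ every formula is equivalent to an existential one) is an
equivalence whose direction `⇒` needs the existential preservation theorem (diagrams and
compactness) and is not discharged here. The direction `⇐` is elementary and is what one uses to
*establish* model completeness of a concrete axiom system from explicit existential equivalents:
existential formulas go up along embeddings (`BoundedFormula.IsExistential.realize_embedding`),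
and applying the hypothesis to `¬φ` as well makes `φ` go down.
-/

namespace FirstOrder.Language.Theory

variable {L : Language.{u, v}} {T : L.Theory}

/-- **Robinson's test, direction `⇐`** (Marker 2002, Prop. 3.1.12; A. Robinson 1956): if every
formula is `T`-equivalent to an existential formula, then `T` is model complete — embeddings
between models of `T` preserve existential formulas, and, the negation of a formula being also
equivalent to an existential one, reflect them. [cite: Marker2002, Prop. 3.1.12] -/
theorem IsModelComplete.of_forall_exists_isExistential
    (h : ∀ (n : ℕ) (φ : L.Formula (Fin n)),
      ∃ ψ : L.Formula (Fin n), ψ.IsExistential ∧ (φ ⇔[T] ψ)) :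
    T.IsModelComplete := by
  intro M N f n φ x
  -- existential equivalents of `φ` and of `¬ φ`
  obtain ⟨ψ, hψ, hiff⟩ := h n φ
  obtain ⟨ψ', hψ', hiff'⟩ := h n φ.not
  have up : ∀ {χ : L.Formula (Fin n)}, χ.IsExistential → χ.Realize x → χ.Realize (f ∘ x) := by
    intro χ hχ hx
    have := hχ.realize_embedding f (v := x) (xs := (default : Fin 0 → M)) hx
    unfold Formula.Realize
    rwa [show (f ∘ (default : Fin 0 → M)) = default from Subsingleton.elim _ _] at this
  constructor
  · intro hN
    by_contra hM
    have h1 : ψ'.Realize x := (hiff'.realize_iff (M := (M : Type _))).1 hM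
    have h2 : (φ.not).Realize (f ∘ x) := (hiff'.realize_iff (M := (N : Type _))).2 (up hψ' h1)
    exact h2 hN
  · intro hM
    have h1 : ψ.Realize x := (hiff.realize_iff (M := (M : Type _))).1 hM
    exact (hiff.realize_iff (M := (N : Type _))).2 (up hψ h1)

/-- The two directions of the named fact `isModelComplete_iff_forall_exists_isExistential`
separated: its content beyond `IsModelComplete.of_forall_exists_isExistential` is the direction
`⇒` (the existential preservation theorem). [cite: Marker2002, Prop. 3.1.12] -/
theorem isModelComplete_iff_forall_exists_isExistential_of_mp
    (hmp : T.IsModelComplete → ∀ (n : ℕ) (φ : L.Formula (Fin n)),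
      ∃ ψ : L.Formula (Fin n), ψ.IsExistential ∧ (φ ⇔[T] ψ)) :
    isModelComplete_iff_forall_exists_isExistential (T := T) :=
  ⟨hmp, IsModelComplete.of_forall_exists_isExistential⟩

end FirstOrder.Language.Theory
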